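import Summits.QuantumFields.YangMills.Theorems.LuscherReductionTwistedTraceScalingBOCoreComplement
import Summits.QuantumFields.YangMills.Theorems.LuscherReductionTwistedTraceScalingInnerVacuumSplit
import HarnessLib

/-!
# The SHELL of the frozen profile is `e^{-cℓ²}`-small — CONDITIONALLY on the discrete Poincaré lemma `ker(covCurl 1) ≤ const ⊔ gauge`
# (lane A of S-BASE, crux `TwistedTraceScaling` stmt-QuantumFields-20203, C4-CORE, the (OD) pen; `pub/ym-fleet/ym-luscher-20007-p1/HANDOFF-g19.md` step (4))

The (B-OD) constant carries the ratio (fibre mass of `Ω_c` over the whole profile ball `‖x‖ ≤ r_f`)/(mass over the inner core `‖x‖ ≤ r_f/12`), with integrand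
`e^{−‖P_Γx‖²/(powScale 1 β)²}·e^{−2q_{β/2,β}(x)}` on balanced (`⟂ constModes`) fibre vectors.  The shell is negligible iff this integrand is `e^{-cℓ²}`-small for
`‖x‖ ≥ r_f/12`, i.e. iff the quadratic form `β²‖P_Γx‖² + 2q(x)` is COERCIVE on `constModesᗮ`.  This file reduces that coercivity to ONE linear-algebra fact not (yet) in the tree,
the discrete Poincaré/Hodge lemma on the 3-torus `(H) ker(covCurl 1) ≤ constModes ⊔ gaugeModes` (curl-free lattice 1-forms are gradients plus constants):
* §1 `inner_smul_stiffHessian_eq_sum` (spectral sum `⟪x,(tH)x⟫ = Σᵢ aᵢ⟪eᵢ,x⟫²`), ★ `inner_smul_stiffHessian_le_stiffGaussExp` (`t·‖dx‖² = ⟪x,(tH)x⟫ ≤ q_{t,b}(x)` for `t, b ≥ 0`: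
  the coefficients `√(aᵢ²+2aᵢb) ≥ aᵢ`);
* §2 `starProjection_gaugeModes_of_mem_constModes` / `inner_eq_zero_of_mem_constModes_of_mem_gaugeModes` (constants `⟂ Γ`, telescoping), `sub_starProjection_mem_stiffSpace_of_hodge` (under (H): for `x ⟂ constModes`, `x − P_Γx ∈ stiffSpace`);
* §3 ★★ `shell_exponent_ge_of_hodge` — under (H), `L ≥ 2`, `t, b ≥ 0`: for `x ⟂ constModes`,
  `t·(2 − 2cos(2π/L))·‖x − P_Γx‖² ≤ q_{t,b}(x)` and `‖x‖² = ‖P_Γx‖² + ‖x − P_Γx‖²`; hence ★★ `shell_gauss_le_of_hodge`: with `s > 0`,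
  `e^{−‖P_Γx‖²/s²}·e^{−q(x)}² ≤ e^{−min(1/s², 2t(2−2cos(2π/L)))·‖x‖²}` — on schedule B (`s = β^{-1}`, `t = β/2`, `‖x‖ ≥ β^{-1/2}ℓ/12`) this is `e^{−(2−2cos(2π/L))ℓ²/144}`.
HONEST FRAMING: conditional on (H) (a pure finite-dimensional statement, filed as a request); the mass ratio, (C5), the final `b`, (B-ST), C4-CORE OPEN; stub of a child of the
CONDITIONAL route R2b1; not infinite volume, not a gap, not Clay.
-/

set_option autoImplicit false

noncomputable section

open Real Module
open scoped BigOperators InnerProductSpace RealInnerProductSpace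
open Literature.MathematicalPhysics.QuantumFieldTheory
open Literature.MathematicalPhysics.QuantumLattice

namespace Summit.QuantumFields.YangMills.Theorems.FemtoTransferGap.TwoLattice.ConstTube

open Summit.QuantumFields.YangMills.Theorems.FemtoTransferGap
open Summit.QuantumFields.YangMills.Theorems.FemtoTransferGap.TwoLattice
open Summit.QuantumFields.YangMills.Theorems.FemtoTransferGap.TwoLattice.Stiff
open Summit.QuantumFields.YangMills.Theorems.FemtoTransferGap.TwoLattice.Toron
open Summit.QuantumFields.YangMills.Theorems.FemtoTransferGap.TwoLattice.Cov

variable {L : ℕ} [NeZero L]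

/-! ## §1 The stiff exponent dominates the curl form -/

/-- Spectral sum: `⟪x, (t·H)x⟫ = Σᵢ aᵢ·⟪eᵢ, x⟫²` in the eigenframe of `t·H`. [folklore] -/
theorem inner_smul_stiffHessian_eq_sum (t : ℝ) (x : LinkSpace L) :
    ⟪x, (t • stiffHessian L) x⟫ = ∑ i, (isSymmetric_smul_stiffHessian (L := L) t).eigenvalues finrank_euclideanSpace i *
      ⟪(isSymmetric_smul_stiffHessian (L := L) t).eigenvectorBasis finrank_euclideanSpace i, x⟫ ^ 2 := by
  set hT := isSymmetric_smul_stiffHessian (L := L) t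
  set e := hT.eigenvectorBasis finrank_euclideanSpace with he
  rw [← e.sum_inner_mul_inner x ((t • stiffHessian L) x)]
  refine Finset.sum_congr rfl fun i _ => ?_
  have h1 : ⟪e i, (t • stiffHessian L) x⟫ = hT.eigenvalues finrank_euclideanSpace i * ⟪e i, x⟫ := by
    have h := hT.eigenvectorBasis_apply_self_apply finrank_euclideanSpace x i
    rw [OrthonormalBasis.repr_apply_apply, OrthonormalBasis.repr_apply_apply] at h
    rw [he]; exact h
  rw [h1, real_inner_comm x (e i)]; ring

/-- ★ **`⟪x,(t·H)x⟫ ≤ q_{t,b}(x)`** for `t ≥ 0`, `b ≥ 0` (each coefficient `√(aᵢ² + 2aᵢb) ≥ aᵢ ≥ 0`). [folklore] -/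
theorem inner_smul_stiffHessian_le_stiffGaussExp {t : ℝ} (ht : 0 ≤ t) {b : ℝ} (hb : 0 ≤ b) (x : LinkSpace L) :
    ⟪x, (t • stiffHessian L) x⟫ ≤ stiffGaussExp L t b x := by
  rw [inner_smul_stiffHessian_eq_sum]
  unfold stiffGaussExp
  refine Finset.sum_le_sum fun i _ => mul_le_mul_of_nonneg_right ?_ (sq_nonneg _)
  set a := (isSymmetric_smul_stiffHessian (L := L) t).eigenvalues finrank_euclideanSpace i
  have ha : 0 ≤ a := smul_stiffHessian_eigenvalues_nonneg ht i
  calc a = Real.sqrt (a ^ 2) := (Real.sqrt_sq ha).symm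
    _ ≤ Real.sqrt (a ^ 2 + 2 * a * b) := Real.sqrt_le_sqrt (by nlinarith [mul_nonneg ha hb])

/-- ★ **`t·‖covCurl 1 x‖² ≤ q_{t,b}(x)`** (`⟪x, Hx⟫ = ‖dx‖²`, `d = covCurl 1 = latCurl`). [cite: Wipf2021, §8.5.2] -/
theorem mul_norm_covCurl_sq_le_stiffGaussExp {t : ℝ} (ht : 0 ≤ t) {b : ℝ} (hb : 0 ≤ b) (x : LinkSpace L) :
    t * ‖covCurl (1 : GaugeConfig 3 L SU2) x‖ ^ 2 ≤ stiffGaussExp L t b x := by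
  have h := inner_smul_stiffHessian_le_stiffGaussExp ht hb x
  rw [LinearMap.smul_apply, inner_smul_right, inner_stiffHessian, ← covCurl_one] at h
  exact h

/-! ## §2 Constants are orthogonal to the gauge modes; under (H) the `Γ`-orthogonal part of a balanced vector is stiff -/

/-- **Constants `⟂ Γ`**: `P_Γ c = 0` for `c ∈ constModes` (telescoping along each direction). [folklore] -/
theorem starProjection_gaugeModes_of_mem_constModes {c : LinkSpace L} (hc : c ∈ constModes L) : (gaugeModes L).starProjection c = 0 := by
  rw [eq_constForm_of_mem_constModes hc]
  exact starProjection_constMode_eq_zero (L := L) (fun k a => c (((0 : Site 3 L), k), a))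

/-- `⟪c, g⟫ = 0` for `c ∈ constModes`, `g ∈ gaugeModes`. [folklore] -/
theorem inner_eq_zero_of_mem_constModes_of_mem_gaugeModes {c g : LinkSpace L} (hc : c ∈ constModes L) (hg : g ∈ gaugeModes L) : ⟪c, g⟫ = 0 := by
  have h := starProjection_gaugeModes_of_mem_constModes (L := L) hc
  rw [Submodule.starProjection_apply_eq_zero_iff] at h
  rw [real_inner_comm]
  exact (Submodule.mem_orthogonal _ _).1 h g hg

/-- ★ **Under (H), the `Γ`-orthogonal part of a balanced vector is stiff**: if `ker(covCurl 1) ≤ constModes ⊔ gaugeModes` and `x ⟂ constModes`, then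
`x − P_Γx ∈ stiffSpace L = (ker covCurl 1)ᗮ`. [folklore] -/
theorem sub_starProjection_mem_stiffSpace_of_hodge
    (hH : LinearMap.ker (covCurl (1 : GaugeConfig 3 L SU2)) ≤ constModes L ⊔ gaugeModes L)
    {x : LinkSpace L} (hx : ∀ c ∈ constModes L, ⟪c, x⟫ = 0) :
    x - (gaugeModes L).starProjection x ∈ stiffSpace L := by
  rw [mem_stiffSpace]
  intro v hv
  have hv' : v ∈ constModes L ⊔ gaugeModes L := hH (LinearMap.mem_ker.2 hv)
  obtain ⟨c, hc, g, hg, rfl⟩ := Submodule.mem_sup.1 hv'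
  have hy : x - (gaugeModes L).starProjection x ∈ (gaugeModes L)ᗮ := Submodule.sub_starProjection_mem_orthogonal x
  have h1 : ⟪c, x - (gaugeModes L).starProjection x⟫ = 0 := by
    rw [inner_sub_right, hx c hc, inner_eq_zero_of_mem_constModes_of_mem_gaugeModes hc (Submodule.starProjection_apply_mem _ x), sub_zero]
  have h2 : ⟪g, x - (gaugeModes L).starProjection x⟫ = 0 := (Submodule.mem_orthogonal _ _).1 hy g hg
  rw [inner_add_left, h1, h2, add_zero]

/-! ## §3 ★★ Coercivity of the shell exponent under (H) -/

/-- ★★ **SHELL COERCIVITY UNDER (H).**  If `ker(covCurl 1) ≤ constModes ⊔ gaugeModes`, `L ≥ 2`, `t, b ≥ 0`, then for every `x ⟂ constModes`: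
`t·(2 − 2cos(2π/L))·‖x − P_Γx‖² ≤ q_{t,b}(x)` and `‖x‖² = ‖P_Γx‖² + ‖x − P_Γx‖²`. [cite: Luscher1983, §3] -/
theorem shell_exponent_ge_of_hodge (hL : 2 ≤ L)
    (hH : LinearMap.ker (covCurl (1 : GaugeConfig 3 L SU2)) ≤ constModes L ⊔ gaugeModes L) {t : ℝ} (ht : 0 ≤ t) {b : ℝ} (hb : 0 ≤ b)
    {x : LinkSpace L} (hx : ∀ c ∈ constModes L, ⟪c, x⟫ = 0) :
    t * (2 - 2 * Real.cos (2 * Real.pi / L)) * ‖x - (gaugeModes L).starProjection x‖ ^ 2 ≤ stiffGaussExp L t b x ∧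
      ‖x‖ ^ 2 = ‖(gaugeModes L).starProjection x‖ ^ 2 + ‖x - (gaugeModes L).starProjection x‖ ^ 2 := by
  set g := (gaugeModes L).starProjection x with hg
  set y := x - g with hy
  have hyS : y ∈ stiffSpace L := sub_starProjection_mem_stiffSpace_of_hodge hH hx
  -- `q(x) = q(y)`: `g ∈ Γ ≤ ker d`, and zero modes do not move `q`
  have hgker : (t • stiffHessian L) g = 0 := by
    have hg0 : latCurl L g = 0 := by
      have := gaugeModes_le_ker (L := L) (Submodule.starProjection_apply_mem (gaugeModes L) x)
      rw [LinearMap.mem_ker, covCurl_one] at this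
      exact this
    rw [LinearMap.smul_apply, stiffHessian_eq_zero_of_latCurl L hg0, smul_zero]
  have hqxy : stiffGaussExp L t b x = stiffGaussExp L t b y := by
    have h := stiffGaussExp_add_of_ker b hgker y
    have e : y + g = x := by rw [hy]; abel
    rw [e] at h
    exact h
  refine ⟨?_, ?_⟩
  · rw [hqxy]
    have hc := stiff_coercive (L := L) hL hyS
    have hq := mul_norm_covCurl_sq_le_stiffGaussExp ht hb y
    calc t * (2 - 2 * Real.cos (2 * Real.pi / L)) * ‖y‖ ^ 2 = t * ((2 - 2 * Real.cos (2 * Real.pi / L)) * ‖y‖ ^ 2) := by ring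
      _ ≤ t * ‖covCurl (1 : GaugeConfig 3 L SU2) y‖ ^ 2 := mul_le_mul_of_nonneg_left hc ht
      _ ≤ stiffGaussExp L t b y := hq
  · -- Pythagoras for the orthogonal projection
    have horth : ⟪g, y⟫ = 0 := by
      have hy' : y ∈ (gaugeModes L)ᗮ := Submodule.sub_starProjection_mem_orthogonal x
      exact (Submodule.mem_orthogonal _ _).1 hy' g (Submodule.starProjection_apply_mem _ x)
    have e : x = g + y := by rw [hy]; abel
    calc ‖x‖ ^ 2 = ‖g + y‖ ^ 2 := by rw [← e]
      _ = ‖g‖ ^ 2 + ‖y‖ ^ 2 := by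
          rw [← real_inner_self_eq_norm_sq, ← real_inner_self_eq_norm_sq, ← real_inner_self_eq_norm_sq,
            inner_add_left, inner_add_right, inner_add_right, horth, real_inner_comm g y, horth]
          ring

/-- ★★ **THE SHELL GAUSSIAN IS SMALL UNDER (H)**: for `x ⟂ constModes`, any real `s`, `t, b ≥ 0`, `L ≥ 2`,
`e^{−‖P_Γx‖²/s²}·(e^{−q_{t,b}(x)})² ≤ e^{−min(1/s², 2t(2−2cos(2π/L)))·‖x‖²}`. [cite: Luscher1983, §3] -/
theorem shell_gauss_le_of_hodge (hL : 2 ≤ L)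
    (hH : LinearMap.ker (covCurl (1 : GaugeConfig 3 L SU2)) ≤ constModes L ⊔ gaugeModes L) {t : ℝ} (ht : 0 ≤ t) {b : ℝ} (hb : 0 ≤ b) (s : ℝ)
    {x : LinkSpace L} (hx : ∀ c ∈ constModes L, ⟪c, x⟫ = 0) :
    Real.exp (-(‖(gaugeModes L).starProjection x‖ ^ 2 / s ^ 2)) * Real.exp (-(stiffGaussExp L t b x)) ^ 2 ≤
      Real.exp (-(min (1 / s ^ 2) (2 * t * (2 - 2 * Real.cos (2 * Real.pi / L))) * ‖x‖ ^ 2)) := by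
  obtain ⟨hq, hpy⟩ := shell_exponent_ge_of_hodge hL hH ht hb hx
  rw [← Real.exp_nat_mul, ← Real.exp_add]
  apply Real.exp_le_exp.2
  push_cast
  set m : ℝ := min (1 / s ^ 2) (2 * t * (2 - 2 * Real.cos (2 * Real.pi / L))) with hm
  have hm1 : m ≤ 1 / s ^ 2 := min_le_left _ _
  have hm2 : m ≤ 2 * t * (2 - 2 * Real.cos (2 * Real.pi / L)) := min_le_right _ _
  have hA : m * ‖(gaugeModes L).starProjection x‖ ^ 2 ≤ ‖(gaugeModes L).starProjection x‖ ^ 2 / s ^ 2 := by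
    rw [div_eq_mul_one_div, mul_comm (‖_‖ ^ 2)]
    exact mul_le_mul_of_nonneg_right hm1 (sq_nonneg _)
  have hB : m * ‖x - (gaugeModes L).starProjection x‖ ^ 2 ≤ 2 * stiffGaussExp L t b x := by
    calc m * ‖x - (gaugeModes L).starProjection x‖ ^ 2 ≤ 2 * t * (2 - 2 * Real.cos (2 * Real.pi / L)) * ‖x - (gaugeModes L).starProjection x‖ ^ 2 :=
          mul_le_mul_of_nonneg_right hm2 (sq_nonneg _)
      _ = 2 * (t * (2 - 2 * Real.cos (2 * Real.pi / L)) * ‖x - (gaugeModes L).starProjection x‖ ^ 2) := by ring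
      _ ≤ 2 * stiffGaussExp L t b x := by linarith
  rw [hpy]
  nlinarith

end Summit.QuantumFields.YangMills.Theorems.FemtoTransferGap.TwoLattice.ConstTube

end
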